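import Mathlib
import Summits.MatrixMultiplication.MatrixMultiplication.Theorems.HiddenToeplitzCornersHiddenCornerLemmaRRankTwoSpacesAux

/-!
# Rank-two pencils: the refined column branch (class `(2,0)` or `(1,1)`)

Support file for crux item `stmt-MatrixMultiplication-10752`
(`Summit.MatrixMultiplication.MatrixMultiplication.Theses.HiddenToeplitzCorners.HiddenCornerLemmaR`),
line `frobenius-dual-short-syzygies`, stub `stub_compressionReduction`; continues
`HiddenToeplitzCornersHiddenCornerLemmaRRankTwoSpacesAux.lean` (frames, (P1), (P2)) and feeds the
refined `d ≤ 2` reduction `hclR_reduction_small_classes`.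

For a family `D` all of whose combinations have rank `≤ 2`, a rank-two member `A` with frame
`(U, Ψ, Y)` and kernel projection `Π = 1 - Y Ψ A`:
* `hclR_column_branch`: if `D i Π = u ⊗ vᵢ` with `u` the first frame vector and some `vᵢ ≠ 0`, then
  EITHER every `D i` has image in `im A` (class `(2,0)`) OR every `D i` is `u ⊗ (row) + (column) ⊗ ν`
  with the fixed functional `ν = (Ψ A) 1` (class `(1,1)`).  Proof: (P2) gives `D i y₁ ∈ im A` for the
  preimage `y₁` of `u`; the `3 × 3` minor of `B = Σ c • D` on rows `(1 - UΨ) a, ψ₁, ψ₀` and columns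
  `y₂, y₁, Π z` is lower triangular, so the product of three linear forms in `c` vanishes identically,
  and one of them is zero (`hclR_three_factor`).
* `hclR_frame_change`: frames can be re-based so that a given non-zero `u ∈ im A` is the first vector.
* `hclR_two_factor`, `hclR_three_factor` (`_fin`: closed form): a product of two / three linear forms
  vanishing identically has a zero factor.
Folklore linear algebra (the compression-space half of the classification of rank-two spaces,
Atkinson–Lloyd 1981), proved here from scratch.
-/

set_option linter.dupNamespace false

namespace Summit.MatrixMultiplication.MatrixMultiplication.Theorems

open Matrix

variable {m n : Type*} [Fintype m] [Fintype n]

/-! ## Small identities -/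

omit [Fintype m] in
/-- `(Σ cⱼ Dⱼ) y = Σ cⱼ (Dⱼ y)`. -/
theorem hclR_sum_smul_mulVec {ι : Type*} [Fintype ι] (D : ι → Matrix m n ℂ) (c : ι → ℂ)
    (y : n → ℂ) : (∑ j, c j • D j) *ᵥ y = ∑ j, c j • (D j *ᵥ y) := by
  classical
  induction (Finset.univ : Finset ι) using Finset.induction_on with
  | empty => simp
  | insert a s ha ih => rw [Finset.sum_insert ha, Finset.sum_insert ha, Matrix.add_mulVec,
      Matrix.smul_mulVec, ih]

omit [Fintype n] in
/-- `w ⬝ (Σ cⱼ gⱼ) = c ⬝ (j ↦ w ⬝ gⱼ)`: a pairing with a combination is a linear form in `c`. -/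
theorem hclR_dot_sum_smul {ι : Type*} [Fintype ι] (w : m → ℂ) (c : ι → ℂ) (g : ι → m → ℂ) :
    w ⬝ᵥ (∑ j, c j • g j) = c ⬝ᵥ fun j => w ⬝ᵥ g j := by
  rw [dotProduct_sum]
  simp only [dotProduct_smul, smul_eq_mul]
  rfl

omit [Fintype m] in
/-- `(u ⊗ v) z = (v ⬝ z) u`. -/
theorem hclR_vecMulVec_mulVec (u : m → ℂ) (v z : n → ℂ) :
    Matrix.vecMulVec u v *ᵥ z = (v ⬝ᵥ z) • u := by
  ext a
  simp [Matrix.mulVec, dotProduct, Matrix.vecMulVec_apply, Finset.mul_sum, mul_comm, mul_left_comm]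

omit [Fintype n] in
/-- `M (u ⊗ v) = (M u) ⊗ v`. -/
theorem hclR_mul_vecMulVec {l : Type*} (M : Matrix l m ℂ) (u : m → ℂ) (v : n → ℂ) :
    M * Matrix.vecMulVec u v = Matrix.vecMulVec (M *ᵥ u) v := by
  ext a k
  simp [Matrix.mul_apply, Matrix.vecMulVec_apply, Matrix.mulVec, dotProduct, Finset.sum_mul,
    mul_assoc]

/-! ## Products of linear forms -/

/-- If the product of two linear forms `c ↦ c ⬝ F`, `c ↦ c ⬝ G` vanishes identically, one of them is
zero. -/
theorem hclR_two_factor {ι : Type*} [Fintype ι] [DecidableEq ι] (F G : ι → ℂ)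
    (h : ∀ c : ι → ℂ, (c ⬝ᵥ F) * (c ⬝ᵥ G) = 0) : F = 0 ∨ G = 0 := by
  by_contra hcon
  push Not at hcon
  obtain ⟨j₁, hj₁⟩ := Function.ne_iff.mp hcon.1
  obtain ⟨j₂, hj₂⟩ := Function.ne_iff.mp hcon.2
  have e1 := h (Pi.single j₁ 1)
  have e2 := h (Pi.single j₂ 1)
  have e3 := h (Pi.single j₁ 1 + Pi.single j₂ 1)
  simp only [add_dotProduct, single_one_dotProduct, Pi.zero_apply] at e1 e2 e3 hj₁ hj₂
  have hG1 : G j₁ = 0 := by simpa [hj₁] using e1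
  have hF2 : F j₂ = 0 := by simpa [hj₂] using e2
  rw [hG1, hF2, add_zero, zero_add] at e3
  exact mul_ne_zero hj₁ hj₂ e3

/-- If the product of three linear forms in `c` vanishes identically, one of them is zero
(coefficients of the cubic `t ↦ (f + tf')(g + tg')(h + th')` at `t = 0, 1, -1, 2`). -/
theorem hclR_three_factor {ι : Type*} [Fintype ι] [DecidableEq ι] (F G H : ι → ℂ)
    (h : ∀ c : ι → ℂ, (c ⬝ᵥ F) * (c ⬝ᵥ G) * (c ⬝ᵥ H) = 0) : F = 0 ∨ G = 0 ∨ H = 0 := by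
  by_cases hH : H = 0
  · exact Or.inr (Or.inr hH)
  obtain ⟨j, hj⟩ := Function.ne_iff.mp hH
  simp only [Pi.zero_apply] at hj
  have key : ∀ c : ι → ℂ, (c ⬝ᵥ F) * (c ⬝ᵥ G) = 0 := by
    intro c
    have e0 := h c
    have e1 := h (c + (1 : ℂ) • Pi.single j 1)
    have e2 := h (c + (-1 : ℂ) • Pi.single j 1)
    have e3 := h (c + (2 : ℂ) • Pi.single j 1)
    simp only [add_dotProduct, smul_dotProduct, single_one_dotProduct, smul_eq_mul] at e1 e2 e3
    have ha3 : F j * G j * H j = 0 := by linear_combination e3 / 6 + e0 / 2 - e1 / 2 - e2 / 6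
    have ha2 : (c ⬝ᵥ F) * G j * H j + F j * (c ⬝ᵥ G) * H j + F j * G j * (c ⬝ᵥ H) = 0 := by
      linear_combination (e1 + e2) / 2 - e0
    have ha1 : (c ⬝ᵥ F) * (c ⬝ᵥ G) * H j + (c ⬝ᵥ F) * G j * (c ⬝ᵥ H) +
        F j * (c ⬝ᵥ G) * (c ⬝ᵥ H) = 0 := by
      linear_combination e1 - e2 / 3 - e3 / 6 - e0 / 2
    have hFG : F j * G j = 0 := by
      rcases mul_eq_zero.mp ha3 with h3 | h3
      · exact h3
      · exact absurd h3 hj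
    have hmix : ((c ⬝ᵥ F) * G j + F j * (c ⬝ᵥ G)) * H j = 0 := by
      linear_combination ha2 - (c ⬝ᵥ H) * hFG
    have hmix' : (c ⬝ᵥ F) * G j + F j * (c ⬝ᵥ G) = 0 := by
      rcases mul_eq_zero.mp hmix with h3 | h3
      · exact h3
      · exact absurd h3 hj
    have hfin : (c ⬝ᵥ F) * (c ⬝ᵥ G) * H j = 0 := by
      linear_combination ha1 - (c ⬝ᵥ H) * hmix'
    rcases mul_eq_zero.mp hfin with h3 | h3
    · exact h3
    · exact absurd h3 hj
  rcases hclR_two_factor F G key with hF | hG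
  · exact Or.inl hF
  · exact Or.inr (Or.inl hG)

/-- `hclR_three_factor` in closed form over `Fin k`: if a product of three linear forms
`c ↦ c ⬝ F`, `c ↦ c ⬝ G`, `c ↦ c ⬝ H` on `ℂ^k` vanishes identically, one of `F, G, H` is zero. -/
theorem hclR_three_factor_fin : ∀ (k : ℕ) (F G H : Fin k → ℂ),
    (∀ c : Fin k → ℂ, dotProduct c F * dotProduct c G * dotProduct c H = 0) →
    F = 0 ∨ G = 0 ∨ H = 0 :=
  fun _ F G H h => hclR_three_factor F G H h

/-! ## Frames re-based at a prescribed image vector -/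

/-- A frame `(U, Ψ, Y)` of `A` can be re-based so that a prescribed non-zero `u ∈ im A` (i.e.
`U Ψ u = u`) becomes the first frame vector, without changing the kernel projection `Y Ψ A`. -/
theorem hclR_frame_change [DecidableEq m] {A : Matrix m n ℂ} {U : Matrix m (Fin 2) ℂ}
    {Ψ : Matrix (Fin 2) m ℂ} {Y : Matrix n (Fin 2) ℂ} (hΨU : Ψ * U = 1) (hAY : A * Y = U)
    (hUΨA : U * (Ψ * A) = A) {u : m → ℂ} (hu : U *ᵥ (Ψ *ᵥ u) = u) (hu0 : u ≠ 0) :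
    ∃ (U' : Matrix m (Fin 2) ℂ) (Ψ' : Matrix (Fin 2) m ℂ) (Y' : Matrix n (Fin 2) ℂ),
      Ψ' * U' = 1 ∧ A * Y' = U' ∧ U' * (Ψ' * A) = A ∧ Y' * (Ψ' * A) = Y * (Ψ * A) ∧
      (fun a => U' a 0) = u := by
  set c : Fin 2 → ℂ := Ψ *ᵥ u with hc
  -- a second column making `[c | c']` invertible
  obtain ⟨x, y, hdet⟩ : ∃ x y : ℂ, c 0 * y - c 1 * x ≠ 0 := by
    by_cases h0 : c 0 = 0
    · refine ⟨1, 0, ?_⟩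
      have h1 : c 1 ≠ 0 := by
        intro h1
        apply hu0
        rw [← hu]
        have : c = 0 := by
          ext i
          fin_cases i
          · exact h0
          · exact h1
        rw [this, Matrix.mulVec_zero]
      simpa [h0] using h1
    · exact ⟨0, 1, by simpa using h0⟩
  set δ : ℂ := c 0 * y - c 1 * x with hδ
  set G : Matrix (Fin 2) (Fin 2) ℂ := !![c 0, x; c 1, y] with hG
  set Gi : Matrix (Fin 2) (Fin 2) ℂ := !![y / δ, -x / δ; -c 1 / δ, c 0 / δ] with hGi
  have hGGi : G * Gi = 1 := by
    ext i j
    fin_cases i <;> fin_cases j <;>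
      simp [hG, hGi, Matrix.mul_apply, Fin.sum_univ_two] <;> field_simp <;> ring
  have hGiG : Gi * G = 1 := by
    ext i j
    fin_cases i <;> fin_cases j <;>
      simp [hG, hGi, Matrix.mul_apply, Fin.sum_univ_two] <;> field_simp <;> ring
  refine ⟨U * G, Gi * Ψ, Y * G, ?_, ?_, ?_, ?_, ?_⟩
  · rw [Matrix.mul_assoc, ← Matrix.mul_assoc Ψ, hΨU, Matrix.one_mul, hGiG]
  · rw [← Matrix.mul_assoc, hAY]
  · rw [Matrix.mul_assoc Gi, ← Matrix.mul_assoc, Matrix.mul_assoc U, hGGi, Matrix.mul_one, hUΨA]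
  · rw [Matrix.mul_assoc Gi, ← Matrix.mul_assoc, Matrix.mul_assoc Y, hGGi, Matrix.mul_one]
  · rw [← hu]
    ext a
    simp [hG, Matrix.mul_apply, Matrix.mulVec, dotProduct, Fin.sum_univ_two, hc]

/-! ## The refined column branch (class `(2,0)` or `(1,1)`) -/

/-- **Column branch.** Let `A` have the frame `(U, Ψ, Y)` with first frame vector `u = U e₀`
(preimage `y₁ = Y e₀`, second preimage `y₂ = Y e₁`), all members and `A ±` members of rank `≤ 2`,
and `D i Π = u ⊗ vᵢ` for every `i` with some `vᵢ₀ ≠ 0`.  Then either every `D i` has image in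
`im A` (class `(2,0)`), or every `D i` equals `u ⊗ (vᵢ + λᵢ (ΨA)₀) + (D i y₂) ⊗ (ΨA)₁` with
`λᵢ = ψ₀ (D i y₁)` (class `(1,1)` with the constant column `u` and the constant row `(ΨA)₁`). -/
theorem hclR_column_branch [DecidableEq m] [DecidableEq n] {ι : Type*} [Fintype ι]
    [DecidableEq ι] (D : ι → Matrix m n ℂ) {A : Matrix m n ℂ} {U : Matrix m (Fin 2) ℂ}
    {Ψ : Matrix (Fin 2) m ℂ} {Y : Matrix n (Fin 2) ℂ} (hΨU : Ψ * U = 1) (hAY : A * Y = U)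
    (hUΨA : U * (Ψ * A) = A)
    (hrk : ∀ c : ι → ℂ, (∑ i, c i • D i).rank ≤ 2 ∧ (A + ∑ i, c i • D i).rank ≤ 2 ∧
      (A - ∑ i, c i • D i).rank ≤ 2)
    (v : ι → n → ℂ)
    (hv : ∀ i, D i * (1 - Y * (Ψ * A)) = Matrix.vecMulVec (fun a => U a 0) (v i))
    (i₀ : ι) (hi₀ : v i₀ ≠ 0) :
    (∀ i, (1 - U * Ψ) * D i = 0) ∨
    (∀ i, D i = Matrix.vecMulVec (fun a => U a 0)
        (v i + (Ψ 0 ⬝ᵥ (D i *ᵥ fun k => Y k 0)) • (Ψ * A) 0) +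
      Matrix.vecMulVec (D i *ᵥ fun k => Y k 1) ((Ψ * A) 1)) := by
  set u : m → ℂ := fun a => U a 0 with hudef
  set y₁ : n → ℂ := fun k => Y k 0 with hy₁
  set y₂ : n → ℂ := fun k => Y k 1 with hy₂
  set W : Matrix m m ℂ := 1 - U * Ψ with hWdef
  set P : Matrix n n ℂ := 1 - Y * (Ψ * A) with hPdef
  have hDi : ∀ i, ∑ j, (Pi.single i (1 : ℂ) : ι → ℂ) j • D j = D i := by
    intro i
    simp [Pi.single_apply, ite_smul, Finset.sum_ite_eq']
  -- basic frame facts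
  have hWU : W * U = 0 := by
    rw [hWdef, Matrix.sub_mul, Matrix.one_mul, Matrix.mul_assoc, hΨU, Matrix.mul_one, sub_self]
  have hWu : W *ᵥ u = 0 := by
    rw [hudef, hclR_mulVec_col, hWU]
    rfl
  have hΨ0u : Ψ 0 ⬝ᵥ u = 1 := by
    have := congrFun (congrFun hΨU 0) 0
    simpa [Matrix.mul_apply, dotProduct, hudef] using this
  have hΨ1u : Ψ 1 ⬝ᵥ u = 0 := by
    have := congrFun (congrFun hΨU 1) 0
    simpa [Matrix.mul_apply, dotProduct, hudef] using this
  have hAy₁ : A *ᵥ y₁ = u := by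
    rw [hy₁, hudef, hclR_mulVec_col, hAY]
  have hAP : A * P = 0 := hclR_frame_mul_proj hAY hUΨA
  have hWA : W * A = 0 := hclR_frame_coproj_mul hUΨA
  have hDPz : ∀ i z, D i *ᵥ (P *ᵥ z) = (v i ⬝ᵥ z) • u := by
    intro i z
    rw [Matrix.mulVec_mulVec, hv i, hclR_vecMulVec_mulVec]
  have hdec : ∀ i, D i = D i * P + D i * Y * (Ψ * A) := by
    intro i
    rw [hPdef, Matrix.mul_sub, Matrix.mul_one, Matrix.mul_assoc, sub_add_cancel]
  -- (a) `D j y₁ ∈ im A` for every `j`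
  obtain ⟨k₀, hk₀⟩ := Function.ne_iff.mp hi₀
  simp only [Pi.zero_apply] at hk₀
  set z₀ : n → ℂ := Pi.single k₀ (v i₀ k₀)⁻¹ with hz₀
  have hvz₀ : v i₀ ⬝ᵥ z₀ = 1 := by
    rw [hz₀, dotProduct_single, mul_inv_cancel₀ hk₀]
  have hx : A *ᵥ (P *ᵥ z₀) = 0 := by
    rw [Matrix.mulVec_mulVec, hAP, Matrix.zero_mulVec]
  obtain ⟨hI, hApI, hAmI⟩ := hrk (Pi.single i₀ 1)
  rw [hDi i₀] at hI hApI hAmI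
  have hfa : ∀ j, W *ᵥ (D j *ᵥ y₁) = 0 := by
    intro j
    ext a
    have hφ : W a ᵥ* A = 0 := by
      rw [hclR_row_vecMul, hWA]
      rfl
    obtain ⟨hD, hApD, hAmD⟩ := hrk (Pi.single j 1)
    rw [hDi j] at hD hApD hAmD
    obtain ⟨hS, hApS, hAmS⟩ := hrk (Pi.single j 1 + Pi.single i₀ 1)
    have hsum : ∑ l, (Pi.single j 1 + Pi.single i₀ 1 : ι → ℂ) l • D l = D j + D i₀ := by
      simp only [Pi.add_apply, add_smul, Finset.sum_add_distrib, hDi]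
    rw [hsum] at hS hApS hAmS
    set lam : ℂ := v j ⬝ᵥ z₀ with hlam
    have e1 : W a ⬝ᵥ (D j *ᵥ (lam • y₁)) = 0 :=
      hclR_P2 hΨU hAY hUΨA hD hApD hAmD hφ hx (by rw [Matrix.mulVec_smul, hAy₁, hDPz])
    have e2 : W a ⬝ᵥ ((D j + D i₀) *ᵥ ((lam + 1) • y₁)) = 0 :=
      hclR_P2 hΨU hAY hUΨA hS hApS hAmS hφ hx
        (by rw [Matrix.mulVec_smul, hAy₁, Matrix.add_mulVec, hDPz, hDPz, hvz₀, add_smul])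
    have e3 : W a ⬝ᵥ (D i₀ *ᵥ y₁) = 0 :=
      hclR_P2 hΨU hAY hUΨA hI hApI hAmI hφ hx (by rw [hAy₁, hDPz, hvz₀, one_smul])
    rw [Matrix.mulVec_smul, dotProduct_smul, smul_eq_mul] at e1
    rw [Matrix.mulVec_smul, dotProduct_smul, smul_eq_mul, Matrix.add_mulVec, dotProduct_add,
      e3, add_zero] at e2
    show W a ⬝ᵥ (D j *ᵥ y₁) = 0
    by_cases hl : lam = 0
    · rw [hl, zero_add, one_mul] at e2
      exact e2
    · exact (mul_eq_zero.mp e1).resolve_left hl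
  -- (b) the lower-triangular `3 × 3` minor: a product of three linear forms in `c` vanishes
  have hBy : ∀ (c : ι → ℂ) (y : n → ℂ), (∑ j, c j • D j) *ᵥ y = ∑ j, c j • (D j *ᵥ y) :=
    fun c y => hclR_sum_smul_mulVec D c y
  have hBPz : ∀ (c : ι → ℂ) (z : n → ℂ),
      (∑ j, c j • D j) *ᵥ (P *ᵥ z) = (c ⬝ᵥ fun j => v j ⬝ᵥ z) • u := by
    intro c z
    rw [hBy]
    simp_rw [hDPz, smul_smul]
    rw [← Finset.sum_smul]
    rfl
  have htri : ∀ (a : m) (z : n → ℂ) (c : ι → ℂ),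
      (c ⬝ᵥ fun j => W a ⬝ᵥ (D j *ᵥ y₂)) * (c ⬝ᵥ fun j => Ψ 1 ⬝ᵥ (D j *ᵥ y₁)) *
        (c ⬝ᵥ fun j => v j ⬝ᵥ z) = 0 := by
    intro a z c
    set w : n → ℂ := P *ᵥ z with hw
    have hBw : (∑ j, c j • D j) *ᵥ w = (c ⬝ᵥ fun j => v j ⬝ᵥ z) • u := by
      rw [hw]
      exact hBPz c z
    have e := hclR_minor3_eq_zero (∑ j, c j • D j) (hrk c).1 ![W a, Ψ 1, Ψ 0] ![y₂, y₁, w]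
    have f1 : W a ⬝ᵥ ((∑ j, c j • D j) *ᵥ y₂) = c ⬝ᵥ fun j => W a ⬝ᵥ (D j *ᵥ y₂) := by
      rw [hBy, hclR_dot_sum_smul]
    have f2 : Ψ 1 ⬝ᵥ ((∑ j, c j • D j) *ᵥ y₁) = c ⬝ᵥ fun j => Ψ 1 ⬝ᵥ (D j *ᵥ y₁) := by
      rw [hBy, hclR_dot_sum_smul]
    have e01 : W a ⬝ᵥ ((∑ j, c j • D j) *ᵥ y₁) = 0 := by
      rw [hBy, hclR_dot_sum_smul]
      have : (fun j => W a ⬝ᵥ (D j *ᵥ y₁)) = 0 := by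
        ext j
        exact congrFun (hfa j) a
      rw [this, dotProduct_zero]
    have e02 : W a ⬝ᵥ ((∑ j, c j • D j) *ᵥ w) = 0 := by
      rw [hBw, dotProduct_smul]
      have : W a ⬝ᵥ u = 0 := congrFun hWu a
      rw [this, smul_zero]
    have e12 : Ψ 1 ⬝ᵥ ((∑ j, c j • D j) *ᵥ w) = 0 := by
      rw [hBw, dotProduct_smul, hΨ1u, smul_zero]
    have e22 : Ψ 0 ⬝ᵥ ((∑ j, c j • D j) *ᵥ w) = c ⬝ᵥ fun j => v j ⬝ᵥ z := by
      rw [hBw, dotProduct_smul, hΨ0u, smul_eq_mul, mul_one]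
    simp only [Matrix.det_fin_three, Matrix.of_apply] at e
    simp [e01, e02, e12, e22, f1, f2] at e
    rcases e with (h | h) | h
    · rw [h, zero_mul, zero_mul]
    · rw [h, mul_zero, zero_mul]
    · rw [h, mul_zero]
  -- (c) one of the three forms vanishes identically
  by_cases hG : (fun j => Ψ 1 ⬝ᵥ (D j *ᵥ y₁)) = 0
  · -- class (1,1)
    right
    intro i
    have hG' : Ψ 1 ⬝ᵥ (D i *ᵥ y₁) = 0 := congrFun hG i
    set lam : ℂ := Ψ 0 ⬝ᵥ (D i *ᵥ y₁) with hlam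
    have hDy₁ : D i *ᵥ y₁ = lam • u := by
      have h1 : W *ᵥ (D i *ᵥ y₁) = 0 := hfa i
      have h2 : W *ᵥ (D i *ᵥ y₁) = D i *ᵥ y₁ - U *ᵥ (Ψ *ᵥ (D i *ᵥ y₁)) := by
        rw [hWdef, Matrix.sub_mulVec, Matrix.one_mulVec, ← Matrix.mulVec_mulVec]
      rw [h2, sub_eq_zero] at h1
      have hc : Ψ *ᵥ (D i *ᵥ y₁) = lam • (Pi.single 0 1 : Fin 2 → ℂ) := by
        ext l
        fin_cases l
        · simp [Matrix.mulVec, hlam]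
        · simp [Matrix.mulVec, hG']
      conv_lhs => rw [h1, hc, Matrix.mulVec_smul]
      congr 1
      ext a
      simp [Matrix.mulVec, hudef]
    have hDY : D i * Y * (Ψ * A) = Matrix.vecMulVec (D i *ᵥ y₁) ((Ψ * A) 0) +
        Matrix.vecMulVec (D i *ᵥ y₂) ((Ψ * A) 1) := by
      ext a k
      simp only [Matrix.mul_apply, Fin.sum_univ_two, Matrix.add_apply, Matrix.vecMulVec_apply,
        Matrix.mulVec, dotProduct, hy₁, hy₂]
    conv_lhs => rw [hdec i, hDY, hv i, hDy₁]
    ext a k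
    simp only [Matrix.add_apply, Matrix.vecMulVec_apply, Pi.add_apply, Pi.smul_apply, smul_eq_mul]
    ring
  · by_cases hH : ∀ z : n → ℂ, (fun j => v j ⬝ᵥ z) = 0
    · exfalso
      apply hk₀
      have := congrFun (hH (Pi.single k₀ 1)) i₀
      simpa using this
    · push Not at hH
      obtain ⟨z₁, hz₁⟩ := hH
      left
      have hF : ∀ a, (fun j => W a ⬝ᵥ (D j *ᵥ y₂)) = 0 := by
        intro a
        rcases hclR_three_factor _ _ _ (htri a z₁) with h1 | h2 | h3
        · exact h1
        · exact absurd h2 hG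
        · exact absurd h3 hz₁
      have hfb : ∀ j, W *ᵥ (D j *ᵥ y₂) = 0 := fun j => by
        ext a
        exact congrFun (hF a) j
      intro i
      have hWDY : W * (D i * Y) = 0 := by
        ext a l
        rw [← hclR_dot_mulVec_col]
        fin_cases l
        · exact congrFun (hfa i) a
        · exact congrFun (hfb i) a
      calc W * D i = W * (D i * P) + W * (D i * Y) * (Ψ * A) := by
            conv_lhs => rw [hdec i]
            rw [Matrix.mul_add, ← Matrix.mul_assoc W (D i * Y) (Ψ * A)]
        _ = 0 := by
            rw [hv i, hclR_mul_vecMulVec, hWu, hWDY, Matrix.zero_mul, add_zero, Matrix.zero_vecMulVec]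

end Summit.MatrixMultiplication.MatrixMultiplication.Theorems
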